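import Literature.AlgebraicGeometry.Resolution.AlterationsSemiStable
import Literature.AlgebraicGeometry.Resolution.AlterationsSemiStableCodimTwo
import Literature.AlgebraicGeometry.Resolution.AlterationsSemiStableThicknessProofs
import Literature.AlgebraicGeometry.Resolution.AlterationsSingFittingSmoothProofs
import Literature.AlgebraicGeometry.Resolution.AlterationsFormalCoordinates
import Literature.AlgebraicGeometry.Resolution.AlterationsNodalMonomialization
import Literature.AlgebraicGeometry.Resolution.AlterationsFormalNodesSingProofs
import Literature.AlgebraicGeometry.Resolution.NodalFamilyRingDomain
import Literature.AlgebraicGeometry.Resolution.NodalDeformation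
import Literature.AlgebraicGeometry.Resolution.NodeFittingTrace
import Literature.AlgebraicGeometry.Resolution.StrictNormalCrossingsFlatDescent
import Literature.AlgebraicGeometry.Resolution.StalkSpecializesLocalization
import Summits.ResolutionOfSingularities.ResolutionOfSingularities.Theorems.WildQuotientsSummitReductionStubPairNodeThickness
import HarnessLib

/-!
# `WildQuotients.SummitReduction` (stmt-ResolutionOfSingularities-16324), line `FramePerfect`, skeleton v8:
# helper lemmas for stub `stub_pair_orbitBlowupCentreNew` (C3) — de Jong 1996, 2.23 + 3.3 at a
# QUASI-SPLIT point of `Sing(f)`, over an arbitrary field and at an arbitrary (not necessarily closed) point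

Route `ResolutionOfSingularities/WildQuotients`, crux `SummitReduction`; worker file supporting the
registered stub `stub_pair_orbitBlowupCentreNew` of the line skeleton (v8, lead c4).

De Jong 1996, 3.3 (p. 63): "Let `A → A' → B` be as in 2.23, and choose an isomorphism
`B ≅ A'⟦u, v⟧/(Q - h)` with `h ∈ A'` … Suppose that `s` lies in the components `D₁, …, D_r` of `D`
but not in any other component. Let `tᵢ ∈ 𝒪_{S,s}` be an element such that `V(tᵢ) = Dᵢ ∩ Spec 𝒪_{S,s}`
… By assumption we have `V(h) ⊂ V(t₁ ⋯ t_r)`. Therefore we see that `h = ε t₁^{n₁} ⋯ t_r^{n_r}`,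
`ε ∈ (A')^*` … We change `Q` into `ε⁻¹Q`. Thus we have `B ≅ A'⟦u, v⟧/(Q - t₁^{n₁} ⋯ t_r^{n_r})`."
The tree proves this for pairs in Situation 4.23 over an ALGEBRAICALLY CLOSED field at CLOSED points
(`DeJong1996SplitNodalStructure_holds`, `DeJong1996.SemiStablePair.exists_baseModel_codimTwo`), where
`A' = A`, `Q = uv` because closed points are rational. For the QUASI-SPLIT `G`-semi-stable pairs of the
line (de Jong 1997, 5.7: at every point `x` of `Sing(f)` the completed fibre ring is `κ(f x)⟦u, v⟧/(uv)`
over `κ(f x)`) the same structure holds at EVERY point of `Sing(f)`, closed or not, over any field: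

* `centreNew_map_stalkIdeal_le_radical` — 3.3, "By assumption we have `V(h) ⊂ V(t₁ ⋯ t_r)`" before
  completion: `I(D)_{f x} 𝒪_{X,x} ⊆ √Fitt₁(Ω_{X/Y})_x` (smoothness over `Y ∖ D`, Stacks 07ZC along the
  generizations of `x`, as in `stub_pair_nodeThickness`);
* `centreNew_exists_nodeModel` — the local algebra: for a flat local `A → B` essentially of finite
  type with the quasi-split datum, `A` regular containing a field, generators `w₁, …, w_m` of `𝔪_A`
  (`m = dim A`) with `(∏_{i<r} wᵢ)^N ∈ Fitt₁(Ω_{B/A})`: Cohen coordinates `ι : Â ≅ κ(A)⟦T₁, …, T_m⟧`,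
  `ŵᵢ ↦ Tᵢ` (Matsumura 29.7, `exists_ringEquiv_adicCompletion_mvPowerSeries_of_rsop`), exponents `ν`
  vanishing beyond `r`, and `e₁ : B̂ ≅ Â⟦u, v⟧/(uv - ∏ ŵᵢ^{νᵢ})` OVER `Â` (Liu 10.3.20 =
  `NodalDeformation.exists_ringEquiv_cpl`; the Remark of 2.23 = `NodeDeformationRing.map_fittingIdeal_eq_span`
  gives `h ∣ (∏_{i<r} ŵᵢ)^N`; unique factorisation in `κ⟦T⟧`; `absorbUnit`);
* `centreNew_exists_baseModel` — the same at a point `x ∈ Sing(f)` of the curve of a quasi-split pair of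
  the line, with `e₁ ∘ (𝒪̂_{Y,f x} → 𝒪̂_{X,x}) = (constants)`;
* `centreNew_formalNodeRing_of_baseModel` — rebracketing through the Cohen coordinates:
  `B̂ ≅ κ⟦u, v, T⟧/(uv - ∏ Tᵢ^{νᵢ})` (`DeJong1996.FormalNodeRing`) with `wᵢ ↦ Tᵢ`, the input format of
  `codimTwo_map_adicCompletion_eq_triplePrime` (3.4 ¶2) and of the chart computation of p. 64.
-/

set_option linter.dupNamespace false

noncomputable section

open CategoryTheory CategoryTheory.Limits AlgebraicGeometry TopologicalSpace
open Literature.AlgebraicGeometry.Resolution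
open Literature.AlgebraicGeometry
open IsLocalRing NodalDeformation Scheme.IdealSheafData DeJong1996 Literature.RingTheory.FittingIdeal

namespace Summit.ResolutionOfSingularities.ResolutionOfSingularities.Theorems

universe u

/-! ## The local algebra of 2.23 + 3.3 at a quasi-split point -/

/-- **de Jong 1996, 2.23 + 3.3 at a quasi-split point — local algebra.** Let `A → B` be a flat local
homomorphism of Noetherian local rings, essentially of finite type, `A` regular and containing a
field `F`, with the quasi-split datum: the completion of the closed fibre `B/𝔪_A B` is
`κ(A)⟦u, v⟧/(uv)` over `κ(A)`. Let `w₁, …, w_m` generate `𝔪_A`, `m = dim A`, and suppose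
`(∏_{i<r} wᵢ)^N ∈ Fitt₁(Ω_{B/A})` for some `N` ("`V(h) ⊂ V(t₁ ⋯ t_r)`"). Then there are exponents
`νᵢ ≥ 0`, zero for `i ≥ r`, Cohen coordinates `ι : Â ≅ κ(A)⟦T₁, …, T_m⟧` with `ŵᵢ ↦ Tᵢ`, and a ring
isomorphism `e₁ : B̂ ≅ Â⟦u, v⟧/(uv - ∏ ŵᵢ^{νᵢ})` with `e₁ ∘ ρ̂ = (constants)` on `Â` ("`B ≅ A⟦u, v⟧/(uv - h)`",
2.23; "`h = ε t₁^{n₁} ⋯ t_r^{n_r}` … We change `Q` into `ε⁻¹Q`", 3.3). Proof: Liu 10.3.20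
(`NodalDeformation.exists_ringEquiv_cpl`) gives `B̂ ≅ Â⟦u, v⟧/(uv - h)` over `Â`; the Remark of 2.23
(`NodeDeformationRing.map_fittingIdeal_eq_span`) sends `Fitt₁ B̂` to `(u, v)`, so reducing modulo
`(u, v)` (`toBaseQuotient`) gives `h ∣ (∏_{i<r} ŵᵢ)^N` in `Â`; in the Cohen coordinates the `Tᵢ` are
prime, so `ι h = ε ∏_{i<r} Tᵢ^{nᵢ}` (`exists_eq_units_mul_prod_pow_of_dvd_prod_pow`), and the unit is
absorbed into `u` (`absorbUnit`). [cite: DeJong1996, 2.23 and 3.3, pp. 61–63] -/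
theorem centreNew_exists_nodeModel {F : Type u} [Field F] {A B : Type u} [CommRing A] [CommRing B]
    [IsRegularLocalRing A] [IsLocalRing B] [IsNoetherianRing B] [Algebra F A] [Algebra A B]
    [IsLocalHom (algebraMap A B)] [Algebra.EssFiniteType A B] (hflat : (algebraMap A B).Flat)
    (e : AdicCompletion ((maximalIdeal B).map (Ideal.Quotient.mk
          ((maximalIdeal A).map (algebraMap A B)))) (B ⧸ (maximalIdeal A).map (algebraMap A B)) ≃+*
      MvPowerSeries (Fin 2) (A ⧸ maximalIdeal A) ⧸
        Ideal.span {(MvPowerSeries.X 0 * MvPowerSeries.X 1 :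
          MvPowerSeries (Fin 2) (A ⧸ maximalIdeal A))})
    (he : e.toRingHom.comp ((algebraMap (B ⧸ (maximalIdeal A).map (algebraMap A B)) _).comp
        (Ideal.quotientMap ((maximalIdeal A).map (algebraMap A B)) (algebraMap A B)
          Ideal.le_comap_map)) =
      algebraMap (A ⧸ maximalIdeal A) _)
    {m r : ℕ} (w : Fin m → A) (hw : Ideal.span (Set.range w) = maximalIdeal A)
    (hm : ringKrullDim A = m) (hrm : r ≤ m)
    (hD : algebraMap A B (∏ i ∈ Finset.univ.filter (fun i : Fin m => i.val < r), w i) ∈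
      (Module.fittingIdeal B Ω[B⁄A] 1).radical) :
    ∃ (ν : Fin m → ℕ) (ι : Cpl A ≃+* MvPowerSeries (Fin m) (ResidueField A))
      (e₁ : Cpl B ≃+* NodeDeformationRing (Cpl A) (∏ i, algebraMap A (Cpl A) (w i) ^ ν i)),
      (∀ i : Fin m, r ≤ i.val → ν i = 0) ∧
      (∀ i, ι (algebraMap A (Cpl A) (w i)) = MvPowerSeries.X i) ∧
      ∀ c : Cpl A, e₁ (complMap (algebraMap A B) c) = NodeDeformationRing.ofBase _ _ c := by
  classical
  have _hrm := hrm
  -- ### 2.23: `e' : Â⟦u, v⟧/(uv - h) ≅ B̂` over `Â`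
  have hres' := exists_sub_mem_maximalIdeal_of_quasiSplit (algebraMap A B) e he
  have hres : Function.Surjective ((residue B).comp (algebraMap A B)) := by
    intro r
    obtain ⟨b, rfl⟩ := residue_surjective r
    obtain ⟨a, ha⟩ := hres' b
    refine ⟨a, ?_⟩
    rw [RingHom.comp_apply]
    show Ideal.Quotient.mk _ _ = Ideal.Quotient.mk _ _
    rw [Ideal.Quotient.mk_eq_mk_iff_sub_mem, ← neg_sub]
    exact Submodule.neg_mem _ ha
  obtain ⟨h, e', -, hC⟩ := NodalDeformation.exists_ringEquiv_cpl (algebraMap A B) hres hflat e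
  have hΨ : ∀ a : A, e'.symm (algebraMap B (Cpl B) (algebraMap A B a)) =
      Ideal.Quotient.mk _ (MvPowerSeries.C (algebraMap A (Cpl A) a)) := by
    intro a
    apply e'.injective
    rw [RingEquiv.apply_symm_apply, hC, NodalDeformation.complMap_algebraMap]
  -- ### the Remark of 2.23: `Fitt₁ · B̂ ↦ (u, v)`
  have htr := DeJong1996.NodeDeformationRing.map_fittingIdeal_eq_span hres' e'.symm hΨ
  -- ### 3.3: `h ∣ (∏_{i<r} ŵᵢ)^N`
  set s : Finset (Fin m) := Finset.univ.filter (fun i : Fin m => i.val < r) with hs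
  set p : A := ∏ i ∈ s, w i with hp
  obtain ⟨N, hN⟩ := Ideal.mem_radical_iff.mp hD
  have h1 : e'.symm (algebraMap B (Cpl B) (algebraMap A B (p ^ N))) ∈
      Ideal.span {Ideal.Quotient.mk _ (MvPowerSeries.X 0), Ideal.Quotient.mk _ (MvPowerSeries.X 1)} := by
    rw [← htr]
    refine Ideal.mem_map_of_mem _ (Ideal.mem_map_of_mem _ ?_)
    rw [map_pow]
    exact hN
  rw [hΨ] at h1
  have h2 : NodeDeformationRing.toBaseQuotient (Cpl A) h
      (Ideal.Quotient.mk _ (MvPowerSeries.C (algebraMap A (Cpl A) (p ^ N)))) = 0 := by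
    have hbot : (Ideal.span {Ideal.Quotient.mk _ (MvPowerSeries.X 0),
        Ideal.Quotient.mk _ (MvPowerSeries.X 1)} :
          Ideal (NodeDeformationRing (Cpl A) h)).map (NodeDeformationRing.toBaseQuotient (Cpl A) h) = ⊥ := by
      rw [Ideal.map_span, Set.image_pair, NodeDeformationRing.toBaseQuotient_mk_X,
        NodeDeformationRing.toBaseQuotient_mk_X, Set.pair_eq_singleton, Ideal.span_singleton_eq_bot]
    have h3 := Ideal.mem_map_of_mem (NodeDeformationRing.toBaseQuotient (Cpl A) h) h1
    rwa [hbot, Ideal.mem_bot] at h3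
  rw [NodeDeformationRing.toBaseQuotient_mk_C, Ideal.Quotient.eq_zero_iff_mem,
    Ideal.mem_span_singleton] at h2
  -- ### Cohen coordinates `ι : Â ≅ κ(A)⟦T⟧`, `ŵᵢ ↦ Tᵢ`
  have hφ : Function.Injective (algebraMap F A) := (algebraMap F A).injective
  let k₀ : Subring A := (algebraMap F A).range
  have hk₀ : IsField k₀ :=
    MulEquiv.isField (Field.toIsField F) (RingEquiv.ofBijective (algebraMap F A).rangeRestrict
      ⟨fun a b hab => hφ (congrArg Subtype.val hab), (algebraMap F A).rangeRestrict_surjective⟩).symm.toMulEquiv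
  obtain ⟨ι, hι⟩ := exists_ringEquiv_adicCompletion_mvPowerSeries_of_rsop A k₀ hk₀
    (RingEquiv.refl (ResidueField A)) w hw hm
  -- ### `ι h = ε ∏_{i<r} Tᵢ^{nᵢ}`
  have hιp : ι (algebraMap A (Cpl A) p) = ∏ i ∈ s, (MvPowerSeries.X i : MvPowerSeries (Fin m) (ResidueField A)) := by
    rw [hp, map_prod, map_prod]
    exact Finset.prod_congr rfl fun i _ => hι i
  have hdvd : ι h ∣ ∏ i ∈ s, (MvPowerSeries.X i : MvPowerSeries (Fin m) (ResidueField A)) ^ N := by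
    obtain ⟨c, hc⟩ := h2
    refine ⟨ι c, ?_⟩
    rw [← map_mul, ← hc, map_pow, map_pow, hιp, Finset.prod_pow]
  haveI : IsDomain (MvPowerSeries (Fin m) (ResidueField A)) := NoZeroDivisors.to_isDomain _
  obtain ⟨nn, ε, hfac⟩ := exists_eq_units_mul_prod_pow_of_dvd_prod_pow s
    (fun i => (MvPowerSeries.X i : MvPowerSeries (Fin m) (ResidueField A)))
    (fun i _ => MvPowerSeries.prime_X' (ResidueField A) i) N hdvd
  -- the exponents on `Fin m`, vanishing beyond `r`
  let ν : Fin m → ℕ := fun i => if i.val < r then nn i else 0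
  set m₀ : Cpl A := ∏ i, algebraMap A (Cpl A) (w i) ^ ν i with hm₀
  have hιm₀ : ι m₀ = ∏ i ∈ s, (MvPowerSeries.X i : MvPowerSeries (Fin m) (ResidueField A)) ^ nn i := by
    rw [hm₀, map_prod, hs, Finset.prod_filter]
    refine Finset.prod_congr rfl fun i _ => ?_
    rw [map_pow, hι i]
    simp only [ν]
    split_ifs <;> simp
  let ε' : (Cpl A)ˣ := Units.map ι.symm.toRingHom.toMonoidHom ε
  have hε'val : (ε' : Cpl A) = ι.symm (ε : MvPowerSeries (Fin m) (ResidueField A)) := rfl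
  have hε' : ι (ε' : Cpl A) = ε := by
    rw [hε'val]
    exact ι.apply_symm_apply _
  have hfac' : h = (ε' : Cpl A) * m₀ := by
    apply ι.injective
    rw [map_mul, hε', hιm₀]
    exact hfac
  have hrel : Ideal.span {nodeDeformationRelation (Cpl A) h} =
      Ideal.span {nodeDeformationRelation (Cpl A) ((ε' : Cpl A) * m₀)} := by rw [← hfac']
  -- ### the isomorphism: 2.23, `ε` absorbed into `u`
  refine ⟨ν, ι, (e'.symm.trans (Ideal.quotEquivOfEq hrel)).trans
    (NodeDeformationRing.absorbUnit ε' m₀), fun i hi => ?_, hι, fun c => ?_⟩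
  · simp only [ν]
    rw [if_neg (by omega)]
  · have h4 : e'.symm (complMap (algebraMap A B) c) = Ideal.Quotient.mk _ (MvPowerSeries.C c) := by
      apply e'.injective
      rw [RingEquiv.apply_symm_apply, hC]
    rw [RingEquiv.trans_apply, RingEquiv.trans_apply, h4, Ideal.quotEquivOfEq_mk,
      NodeDeformationRing.absorbUnit_mk_C, NodeDeformationRing.ofBase_apply]


/-! ## 3.3 before completion: `I(D)_{f x} 𝒪_{X,x} ⊆ √Fitt₁(Ω_{X/Y})_x` -/

/-- **de Jong 1996, 3.3: "By assumption [smoothness over `S ∖ D`] we have `V(h) ⊂ V(t₁ ⋯ t_r)`"**,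
before completion, for the curve `f : X ⟶ Y` of a pair of the line (`Y` regular integral, `D ⊆ Y` a
strict normal crossings divisor, `X` integral projective over `k`, `f` semi-stable and smooth over
`Y ∖ D`) at ANY point `x`: the stalk of the ideal of `D` at `f x` extends into the radical of
`Fitt₁(Ω_{X/Y})_x`, the stalk of the ideal of `Sing(f)` (2.21). Indeed a prime `Q ⊇ Fitt₁` of `𝒪_{X,x}`
is the prime of a generization `x'` of `x` (Stacks 01J7); were `f x' ∉ D`, `f` would be smooth at `x'`,
`Ω_{X/Y,x'}` cyclic (Stacks 01V9, `DeJong1996SmoothIffDifferentialsCyclic_holds`) and some element of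
`Fitt₁` would miss `Q` (Stacks 07ZC, `exists_mem_fittingIdeal_notMem_of_specializes`); so `f x' ∈ D`
and `I(D)_{f x} ⊆ 𝔭_{f x'}`, whose image lies in `Q`. [cite: DeJong1996, 3.3, p. 63] -/
theorem centreNew_map_stalkIdeal_le_radical {Y : Scheme.{0}} (D : Set Y)
    (hD : IsStrictNormalCrossingsDivisor Y D) {X : Scheme.{0}} (f : X ⟶ Y) (hss : IsSemiStableCurve f)
    (hsm : Smooth (f ∣_ ⟨Dᶜ, hD.isClosed.isOpen_compl⟩)) (x : X) :
    (stalkIdeal (vanishingIdeal ⟨D, hD.isClosed⟩) (f.base x)).map (f.stalkMap x).hom ≤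
      (Scheme.Hom.singFittingIdeal f x).radical := by
  haveI := hss.locallyOfFiniteType
  have h2 := DeJong1996SmoothIffDifferentialsCyclic_holds.{0}
  -- `f` is smooth over `Y ∖ D`
  have hsmD : ∀ {x' : X}, f.base x' ∉ D → ∃ U : X.Opens, x' ∈ U ∧ Smooth (U.ι ≫ f) := by
    intro x' hx'
    let V : Y.Opens := ⟨Dᶜ, hD.isClosed.isOpen_compl⟩
    haveI : Smooth (f ∣_ V) := hsm
    refine ⟨f ⁻¹ᵁ V, hx', ?_⟩
    rw [← morphismRestrict_ι]
    infer_instance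
  rw [Ideal.radical_eq_sInf]
  refine le_sInf ?_
  rintro Q ⟨hIQ, hQ⟩
  -- `Q` is the prime of a generization `x'` of `x`, and `f x' ∈ D`
  obtain ⟨x', hx', hQeq⟩ := exists_specializes_comap_stalkSpecializes_eq x Q
  have hy' : f.base x' ⤳ f.base x := hx'.map f.continuous
  have hxD : f.base x' ∈ D := by
    by_contra hxD
    obtain ⟨U, hx'U, hU⟩ := hsmD hxD
    have hcyc := (h2 X Y f hss x').mp ⟨U, hx'U, hU⟩
    obtain ⟨d, hd, hdQ⟩ := exists_mem_fittingIdeal_notMem_of_specializes f hx' hcyc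
    rw [← hQeq] at hdQ
    exact hdQ (hIQ hd)
  -- `I(D)_{f x} ⊆ 𝔭_{f x'}`, whose image lies in `Q`
  have hle := stalkIdeal_vanishingIdeal_le (Z := ⟨D, hD.isClosed⟩) hy' hxD
  rw [Ideal.map_le_iff_le_comap]
  intro a ha
  have ha' : (Y.presheaf.stalkSpecializes hy').hom a ∈ maximalIdeal _ := hle ha
  rw [Ideal.mem_comap, hQeq, Ideal.mem_comap, ← RingHom.comp_apply, ← CommRingCat.hom_comp,
    ← Scheme.Hom.stalkSpecializes_stalkMap f _ _ hx', CommRingCat.hom_comp, RingHom.comp_apply]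
  exact map_nonunit (f.stalkMap x').hom _ ha'

/-! ## The base-compatible formal model at a point of `Sing(f)` of a quasi-split pair -/

/-- **de Jong 1996, 2.23 + 3.3 at a point of `Sing(f)` of a QUASI-SPLIT pair of the line, over any
field** (closed or not). For `Y` regular integral over `k`, `D ⊆ Y` a strict normal crossings
divisor, `X` integral projective over `k`, `f : X ⟶ Y` a quasi-split semi-stable curve smooth over
`Y ∖ D`, a point `x` at which `f` is not smooth, and generators `w₁, …, w_m` of `𝔪_{Y,f x}`
(`m = dim 𝒪_{Y,f x}`) with `I(D)_{f x} = (∏_{i<r} wᵢ)`: there are exponents `νᵢ` (zero for `i ≥ r`),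
Cohen coordinates `ι : 𝒪̂_{Y,f x} ≅ κ(f x)⟦T₁, …, T_m⟧`, `ŵᵢ ↦ Tᵢ`, and a ring isomorphism
`e₁ : 𝒪̂_{X,x} ≅ 𝒪̂_{Y,f x}⟦u, v⟧/(uv - ∏ ŵᵢ^{νᵢ})` compatible with the completed stalk map and the
constants ("`B ≅ A'⟦u, v⟧/(Q - t₁^{n₁} ⋯ t_r^{n_r})` … in the split case we may assume `A = A'` and
`Q = uv`"; here quasi-splitness replaces rationality of closed points over `k = k̄`):
`centreNew_exists_nodeModel` for `𝒪_{Y,f x} → 𝒪_{X,x}` with `centreNew_map_stalkIdeal_le_radical`.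
[cite: DeJong1996, 2.23 and 3.3, pp. 61–63] [cite: DeJong1997, 5.7, p. 614] -/
theorem centreNew_exists_baseModel (k : Type) [Field k] (Y : Scheme.{0}) [IsIntegral Y]
    (q : Y ⟶ Spec (.of k)) (hreg : Scheme.IsRegular Y) (D : Set Y)
    (hD : IsStrictNormalCrossingsDivisor Y D) (X : Scheme.{0}) [IsIntegral X] (f : X ⟶ Y)
    (hprojX : Motives.IsProjectiveOver (Over.mk (f ≫ q))) (hss : IsSemiStableCurve f)
    (hqs : (∀ x : X, (¬ ∃ U : X.Opens, x ∈ U ∧ Smooth (U.ι ≫ f)) →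
        ∃ e : AdicCompletion
            ((IsLocalRing.maximalIdeal (X.presheaf.stalk x)).map (Ideal.Quotient.mk
              ((IsLocalRing.maximalIdeal (Y.presheaf.stalk (f.base x))).map (f.stalkMap x).hom)))
            (X.presheaf.stalk x ⧸
              (IsLocalRing.maximalIdeal (Y.presheaf.stalk (f.base x))).map (f.stalkMap x).hom) ≃+*
          MvPowerSeries (Fin 2) (Y.presheaf.stalk (f.base x) ⧸ IsLocalRing.maximalIdeal (Y.presheaf.stalk (f.base x))) ⧸
            Ideal.span {(MvPowerSeries.X 0 * MvPowerSeries.X 1 :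
              MvPowerSeries (Fin 2) (Y.presheaf.stalk (f.base x) ⧸ IsLocalRing.maximalIdeal (Y.presheaf.stalk (f.base x))))},
          e.toRingHom.comp ((algebraMap (X.presheaf.stalk x ⧸
              (IsLocalRing.maximalIdeal (Y.presheaf.stalk (f.base x))).map (f.stalkMap x).hom) _).comp
            (Ideal.quotientMap ((IsLocalRing.maximalIdeal (Y.presheaf.stalk (f.base x))).map (f.stalkMap x).hom)
              (f.stalkMap x).hom Ideal.le_comap_map)) =
          algebraMap (Y.presheaf.stalk (f.base x) ⧸ IsLocalRing.maximalIdeal (Y.presheaf.stalk (f.base x))) _))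
    (hsm : Smooth (f ∣_ ⟨Dᶜ, hD.isClosed.isOpen_compl⟩))
    (x : X) (hns : ¬ ∃ U : X.Opens, x ∈ U ∧ Smooth (U.ι ≫ f))
    {m r : ℕ} (w : Fin m → Y.presheaf.stalk (f.base x))
    (hw : Ideal.span (Set.range w) = maximalIdeal (Y.presheaf.stalk (f.base x)))
    (hm : ringKrullDim (Y.presheaf.stalk (f.base x)) = m) (hrm : r ≤ m)
    (hI : stalkIdeal (vanishingIdeal ⟨D, hD.isClosed⟩) (f.base x) =
      Ideal.span {∏ i ∈ Finset.univ.filter (fun i : Fin m => i.val < r), w i}) :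
    ∃ (ν : Fin m → ℕ)
      (ι : Cpl (Y.presheaf.stalk (f.base x)) ≃+*
        MvPowerSeries (Fin m) (ResidueField (Y.presheaf.stalk (f.base x))))
      (e₁ : Cpl (X.presheaf.stalk x) ≃+*
        NodeDeformationRing (Cpl (Y.presheaf.stalk (f.base x)))
          (∏ i, algebraMap _ (Cpl (Y.presheaf.stalk (f.base x))) (w i) ^ ν i)),
      (∀ i : Fin m, r ≤ i.val → ν i = 0) ∧
      (∀ i, ι (algebraMap _ _ (w i)) = MvPowerSeries.X i) ∧
      ∀ c, e₁ (completedStalkMap f x c) = NodeDeformationRing.ofBase _ _ c := by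
  haveI : IsNoetherian X := DeJong1996.isNoetherian_of_isProjectiveOver (f ≫ q) hprojX
  haveI : IsLocallyNoetherian Y := isLocallyNoetherian_base hss
  haveI : Flat f := hss.flat
  haveI := hss.locallyOfFiniteType
  let A := Y.presheaf.stalk (f.base x)
  let B := X.presheaf.stalk x
  letI algAB : Algebra A B := (f.stalkMap x).hom.toAlgebra
  haveI : IsLocalHom (algebraMap A B) := inferInstanceAs (IsLocalHom (f.stalkMap x).hom)
  haveI : Algebra.EssFiniteType A B := by
    rw [← RingHom.essFiniteType_algebraMap, RingHom.algebraMap_toAlgebra]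
    exact LocallyOfFiniteType.stalkMap f x
  haveI : IsRegularLocalRing A := hreg (f.base x)
  -- the field `k` inside `𝒪_{Y,f x}`
  letI algkA : Algebra k A :=
    ((Y.presheaf.germ ⊤ (f.base x) trivial).hom.comp
      (q.appTop.hom.comp (Scheme.ΓSpecIso (.of k)).inv.hom)).toAlgebra
  -- the quasi-split datum and `(∏_{i<r} wᵢ)^N ∈ Fitt₁`
  obtain ⟨e, he⟩ := hqs x hns
  have hD' : algebraMap A B (∏ i ∈ Finset.univ.filter (fun i : Fin m => i.val < r), w i) ∈
      (Module.fittingIdeal B Ω[B⁄A] 1).radical := by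
    have h1 := centreNew_map_stalkIdeal_le_radical D hD f hss hsm x
    refine h1 (Ideal.mem_map_of_mem _ ?_)
    rw [hI]
    exact Ideal.mem_span_singleton_self _
  obtain ⟨ν, ι, e₁, hν, hι, he₁⟩ := centreNew_exists_nodeModel (F := k) (A := A) (B := B)
    (Flat.stalkMap f x) e he w hw hm hrm hD'
  exact ⟨ν, ι, e₁, hν, hι, fun c => he₁ c⟩

/-! ## Rebracketing through the Cohen coordinates -/

/-- **The formal node ring form of a base-compatible model.** Given Cohen coordinates
`ι : Â ≅ K⟦T₁, …, T_m⟧` with `ŵᵢ ↦ Tᵢ` and `e₁ : B̂ ≅ Â⟦u, v⟧/(uv - ∏ ŵᵢ^{νᵢ})` under which a ring map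
`ρ : A → B` acts through the constants, the composite
`eM = e₁ ≫ congr ι ≫ toFormalNodeRing : B̂ ≅ K⟦u, v, T⟧/(uv - ∏ Tᵢ^{νᵢ})` (`DeJong1996.FormalNodeRing K m ν`)
sends `ρ(wᵢ)` to `Tᵢ` and `e₁⁻¹(u), e₁⁻¹(v)` to `u, v` — the format of
`codimTwo_map_adicCompletion_eq_triplePrime` and of `FormalNodeRing.blowup_triplePrime_singular_over_centre`.
[folklore] -/
theorem centreNew_formalNodeRing_of_baseModel {A B : Type u} [CommRing A] [IsLocalRing A]
    [CommRing B] [IsLocalRing B] {K : Type u} [Field K] {m : ℕ} (w : Fin m → A) (ν : Fin m → ℕ)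
    (ι : Cpl A ≃+* MvPowerSeries (Fin m) K) (hι : ∀ i, ι (algebraMap A (Cpl A) (w i)) = MvPowerSeries.X i)
    (e₁ : Cpl B ≃+* NodeDeformationRing (Cpl A) (∏ i, algebraMap A (Cpl A) (w i) ^ ν i))
    (ρ : A →+* B)
    (hρ : ∀ a, e₁ (algebraMap B (Cpl B) (ρ a)) =
      NodeDeformationRing.ofBase _ _ (algebraMap A (Cpl A) a)) :
    ∃ (E : NodeDeformationRing (Cpl A) (∏ i, algebraMap A (Cpl A) (w i) ^ ν i) ≃+*
        FormalNodeRing K m ν),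
      (∀ i, (e₁.trans E) (algebraMap B (Cpl B) (ρ (w i))) =
        Ideal.Quotient.mk _ (MvPowerSeries.X (Sum.inr i))) ∧
      (∀ j : Fin 2, E (Ideal.Quotient.mk _ (MvPowerSeries.X j)) =
        Ideal.Quotient.mk _ (MvPowerSeries.X (Sum.inl j))) ∧
      (∀ c : Cpl A, E (NodeDeformationRing.ofBase _ _ c) =
        Ideal.Quotient.mk _ (MvPowerSeriesNested.inrHom (Fin 2) (Fin m) K (ι c))) := by
  have hιm₀ : ι (∏ i, algebraMap A (Cpl A) (w i) ^ ν i) = ∏ i, MvPowerSeries.X i ^ ν i := by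
    rw [map_prod]
    exact Finset.prod_congr rfl fun i _ => by rw [map_pow, hι i]
  refine ⟨(NodeDeformationRing.congr ι _ _ hιm₀).trans (NodeDeformationRing.toFormalNodeRing K m ν),
    fun i => ?_, fun j => ?_, fun c => ?_⟩
  · rw [RingEquiv.trans_apply, hρ, RingEquiv.trans_apply, NodeDeformationRing.ofBase_apply,
      NodeDeformationRing.congr_mk_C, hι i, NodeDeformationRing.toFormalNodeRing_mk_C_X]
  · rw [RingEquiv.trans_apply, NodeDeformationRing.congr_mk_X, NodeDeformationRing.toFormalNodeRing_mk_X]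
  · rw [RingEquiv.trans_apply, NodeDeformationRing.ofBase_apply, NodeDeformationRing.congr_mk_C]
    rfl

end Summit.ResolutionOfSingularities.ResolutionOfSingularities.Theorems

end
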